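import Summits.RiemannHypothesis.RiemannHypothesis.Theses.CharacterSums
import Literature.NumberTheory.LFunctions.ConreyCharacterSumsRH
import Literature.NumberTheory.LFunctions.GeneralizedRH

/-!
# Birth skeleton (BC3) for crux `LiouvilleSineCriterion` — route `RiemannHypothesis/CharacterSums`

Crux (item stmt-RiemannHypothesis-16981, route decl
`Summit.RiemannHypothesis.RiemannHypothesis.Theses.CharacterSums.LiouvilleSineCriterion`):
Conrey 2024, Theorem 1 with "any positive constant" — if for some `δ > 0` the Liouville sine series
`f(x) = ∑ λ(n) sin(2πnx)/n²` (`Literature.NumberTheory.LFunctions.Conrey2024.f`, which is the crux's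
`tsum` verbatim) is `≥ 0` on `[0, δ]`, then `RiemannHypothesis`.

The line is Conrey's printed proof (Acta Arith. 214 (2024), §4 p. 6), cut into three stubs along
its three analytic inputs; the composition `LiouvilleSineCriterion_of` is pure logic plus the tree's
`quasiRiemannHypothesis_one_half_iff_holds` (`QuasiRiemannHypothesis (1/2) ↔ RiemannHypothesis`,
functional equation).

* `stub_mellinIdentity` — **the Mellin identity on the strip** `0 < Re s < 1`:
  `∫₀^∞ f(x) x^{s-2} dx = (2π)^{1-s} Γ(s)/(1-s) · cos(πs/2) · ζ(2s+2)/ζ(s+1)`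
  (= Conrey's `πX(1-s)ζ(2s+2)/((1-s)ζ(s+1))`), absolutely convergent, written as
  `HasMellin (f : ℝ → ℂ) (s-1) _` (Mathlib: `mellin f z = ∫_{Ioi 0} t^{z-1} • f t`).
  Plan: termwise `∫₀^∞ sin(2πnx) x^{s-2} dx = (2πn)^{1-s} Γ(s-1) sin(π(s-1)/2)` by the tree's
  `Literature.Analysis.SpecialFunctions.hasMellin_sin` (`-1 < Re z < 0`, `z = s-1`) and Mathlib
  `mellin_comp_mul_left`; Tonelli/Fubini with the majorant `|f(x)| ≤ min(ζ(2), Cx(1+log(1/x)))`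
  (or termwise `∑ n^{-2}·(2πn)^{1-σ}∫|sin u|u^{σ-2} < ∞`); then `∑ λ(n) n^{-(s+1)} = ζ(2s+2)/ζ(s+1)`
  (`Literature.NumberTheory.LFunctions.LSeries_liouville_eq` at `s+1`), `Γ(s-1) = Γ(s)/(s-1)`,
  `sin(π(s-1)/2) = -cos(πs/2)`. Size M/L.
* `stub_landauContinuation` — **Landau's lemma applied** (Montgomery–Vaughan Lemma 15.1; tree:
  `Literature.NumberTheory.LFunctions.Landau.integrableOn_of_differentiableOn_union_convex`,
  after `x = 1/y`, `g(y) = y f(1/y) 𝟙_{y > 1/δ}` so that `∫₀^δ f x^{s-2} dx = mellinIoi g s`):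
  positivity of `f` on `[0, δ]` and the strip identity force absolute convergence of
  `∫₀^δ f(x) x^{σ-2} dx` for EVERY real `σ > -1/2`, because the continuation
  `M(s) - ∫_δ^∞ f x^{s-2}` (tail holomorphic on `Re s < 1` by absolute convergence, `f` bounded) is
  holomorphic near the real segment `(-1/2, 2]` (no real zeros of `ζ(s+1)`, tree `ZetaRealAxis`;
  removable singularities of the FORMULA at `s = 0` (`Γ(s)/ζ(s+1)`) and `s = 1`
  (`cos(πs/2)/(1-s)`) must be filled — same device as the order-0 sibling
  `LiouvilleOneSided.integrableOn_liouville_rpow_of_oneSided`). Size L. This is where `H = positivity`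
  is consumed (any proof must use it: without positivity the conclusion is RH-strength).
* `stub_zeroFree` — **continuation ⇒ no zeros in `1/2 < Re ρ < 1`**: if `∫₀^δ |f| x^{σ-2} < ∞`
  for all `σ > -1/2` then `G_δ(s) = ∫₀^δ f x^{s-2}` is holomorphic on `Re s > -1/2`,
  `E_δ(s) = ∫_δ^∞ f x^{s-2}` on `Re s < 1`, and `G_δ + E_δ = M` on `0 < Re s < 1`; by the identity
  theorem on the convex strip `-1/2 < Re s < 1` (after clearing the denominator
  `(1-s)·sζ(s+1)`), a zero `ρ` of `ζ` with `1/2 < Re ρ < 1` would make the non-vanishing numerator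
  `(2π)^{2-ρ} cos(π(ρ-1)/2) Γ(ρ) ζ(2ρ)` vanish at `s = ρ - 1`. No positivity and no zero-free input
  needed. Size M.

Composition: `h₂ δ hδ hpos h₁` gives the convergence, `h₃ δ hδ _ h₁` gives
`QuasiRiemannHypothesis (1/2)`, and `quasiRiemannHypothesis_one_half_iff_holds` gives
`RiemannHypothesis` (the crux's conclusion `_root_.RiemannHypothesis`).

Disproof used: none relevant (no `Disproof.lean` / Negative lemmas exist for this crux, `ledger crux ls`
2026-08-17). Sources: Conrey2024CharacterSums (arXiv:2404.19647, Thm 1, proof §4),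
MontgomeryVaughan2007 (Lemma 15.1), Titchmarsh1986 §2.1 (Mellin transform of `sin`).
-/

noncomputable section

open MeasureTheory
open scoped Real

namespace Summit.RiemannHypothesis.RiemannHypothesis.Cruxes.LiouvilleSineCriterion.Birth

open Literature.NumberTheory.LFunctions

/-! ## The three stub statements as named propositions `Sig.stub_*`
(tree convention, cf. `Cruxes/AhfHighReal/Lines/birth.lean`: same short names as the registered stubs,
so the skeleton audit admits them as hypotheses of `LiouvilleSineCriterion_of` by name) -/

namespace Sig

/-- **Stub 1 (Conrey 2024, proof of Thm 1, first display; Titchmarsh §2.1).** The Mellin identity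
`∫₀^∞ f(x) x^{s-2} dx = (2π)^{1-s} Γ(s)/(1-s) cos(πs/2) ζ(2s+2)/ζ(s+1)` on `0 < Re s < 1`, with
absolute convergence (`HasMellin` at `s - 1`). Size M. -/
def stub_mellinIdentity : Prop :=
    ∀ s : ℂ, 0 < s.re → s.re < 1 →
        HasMellin (fun x : ℝ => (Conrey2024.f x : ℂ)) (s - 1)
          ((2 * π : ℂ) ^ (1 - s) * (Complex.Gamma s / (1 - s)) * Complex.cos (π * s / 2) *
            (riemannZeta (2 * s + 2) / riemannZeta (s + 1)))

/-- **Stub 2 (Landau's lemma, MV Lemma 15.1, applied as in Conrey §4).** Positivity of `f` on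
`[0, δ]` plus the strip identity give absolute convergence of `∫₀^δ f(x) x^{σ-2} dx` for every real
`σ > -1/2` (the rightmost real singularity of the continuation is the pole of `ζ(2s+2)` at
`s = -1/2`). The ONLY stub that consumes the positivity hypothesis. Size L. -/
def stub_landauContinuation : Prop :=
    ∀ δ : ℝ, 0 < δ → (∀ x : ℝ, 0 ≤ x → x ≤ δ → 0 ≤ Conrey2024.f x) →
      (∀ s : ℂ, 0 < s.re → s.re < 1 →
        HasMellin (fun x : ℝ => (Conrey2024.f x : ℂ)) (s - 1)
          ((2 * π : ℂ) ^ (1 - s) * (Complex.Gamma s / (1 - s)) * Complex.cos (π * s / 2) *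
            (riemannZeta (2 * s + 2) / riemannZeta (s + 1)))) →
      ∀ σ : ℝ, -1 / 2 < σ →
        IntegrableOn (fun x : ℝ => Conrey2024.f x * x ^ (σ - 2)) (Set.Ioc 0 δ)

/-- **Stub 3 (identity theorem + pole bookkeeping).** Absolute convergence of `∫₀^δ f x^{σ-2}` for
all `σ > -1/2` and the strip identity continue `M(s)` holomorphically to `-1/2 < Re s < 1`, so
`ζ(s+1)` has no zeros with `-1/2 < Re s < 0`: `QuasiRiemannHypothesis (1/2)`. Size M. -/
def stub_zeroFree : Prop :=
    ∀ δ : ℝ, 0 < δ →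
      (∀ σ : ℝ, -1 / 2 < σ →
        IntegrableOn (fun x : ℝ => Conrey2024.f x * x ^ (σ - 2)) (Set.Ioc 0 δ)) →
      (∀ s : ℂ, 0 < s.re → s.re < 1 →
        HasMellin (fun x : ℝ => (Conrey2024.f x : ℂ)) (s - 1)
          ((2 * π : ℂ) ^ (1 - s) * (Complex.Gamma s / (1 - s)) * Complex.cos (π * s / 2) *
            (riemannZeta (2 * s + 2) / riemannZeta (s + 1)))) →
      QuasiRiemannHypothesis (1 / 2)

end Sig

/-! ## The registered stubs (signatures spelled out verbatim over importable declarations;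
`sorry` lives ONLY here) -/

/-- Registered stub `stub_mellinIdentity` (= `Sig.stub_mellinIdentity`, verbatim). -/
theorem stub_mellinIdentity :
    ∀ s : ℂ, 0 < s.re → s.re < 1 →
        HasMellin (fun x : ℝ => (Conrey2024.f x : ℂ)) (s - 1)
          ((2 * π : ℂ) ^ (1 - s) * (Complex.Gamma s / (1 - s)) * Complex.cos (π * s / 2) *
            (riemannZeta (2 * s + 2) / riemannZeta (s + 1))) := by
  sorry

/-- Registered stub `stub_landauContinuation` (= `Sig.stub_landauContinuation`, verbatim). -/
theorem stub_landauContinuation :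
    ∀ δ : ℝ, 0 < δ → (∀ x : ℝ, 0 ≤ x → x ≤ δ → 0 ≤ Conrey2024.f x) →
      (∀ s : ℂ, 0 < s.re → s.re < 1 →
        HasMellin (fun x : ℝ => (Conrey2024.f x : ℂ)) (s - 1)
          ((2 * π : ℂ) ^ (1 - s) * (Complex.Gamma s / (1 - s)) * Complex.cos (π * s / 2) *
            (riemannZeta (2 * s + 2) / riemannZeta (s + 1)))) →
      ∀ σ : ℝ, -1 / 2 < σ →
        IntegrableOn (fun x : ℝ => Conrey2024.f x * x ^ (σ - 2)) (Set.Ioc 0 δ) := by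
  sorry

/-- Registered stub `stub_zeroFree` (= `Sig.stub_zeroFree`, verbatim). -/
theorem stub_zeroFree :
    ∀ δ : ℝ, 0 < δ →
      (∀ σ : ℝ, -1 / 2 < σ →
        IntegrableOn (fun x : ℝ => Conrey2024.f x * x ^ (σ - 2)) (Set.Ioc 0 δ)) →
      (∀ s : ℂ, 0 < s.re → s.re < 1 →
        HasMellin (fun x : ℝ => (Conrey2024.f x : ℂ)) (s - 1)
          ((2 * π : ℂ) ^ (1 - s) * (Complex.Gamma s / (1 - s)) * Complex.cos (π * s / 2) *
            (riemannZeta (2 * s + 2) / riemannZeta (s + 1)))) →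
      QuasiRiemannHypothesis (1 / 2) := by
  sorry

/-! ## Composition (sorry-free) and the skeleton theorem -/

/-- **Composition (kernel-checked, no sorry).** The three stub statements give the crux BY NAME:
Landau (stub 2, fed by positivity and stub 1) gives convergence on `σ > -1/2`; stub 3 turns that
into `QuasiRiemannHypothesis (1/2)`; the tree's `quasiRiemannHypothesis_one_half_iff_holds`
(functional equation) gives Mathlib's `RiemannHypothesis`, the crux's conclusion. -/
theorem LiouvilleSineCriterion_of (h₁ : Sig.stub_mellinIdentity) (h₂ : Sig.stub_landauContinuation)
    (h₃ : Sig.stub_zeroFree) :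
    Summit.RiemannHypothesis.RiemannHypothesis.Theses.CharacterSums.LiouvilleSineCriterion := by
  intro δ hδ hpos
  have hpos' : ∀ x : ℝ, 0 ≤ x → x ≤ δ → 0 ≤ Conrey2024.f x := fun x hx hxδ => hpos x hx hxδ
  have hI : ∀ σ : ℝ, -1 / 2 < σ →
      IntegrableOn (fun x : ℝ => Conrey2024.f x * x ^ (σ - 2)) (Set.Ioc 0 δ) :=
    h₂ δ hδ hpos' h₁
  have hQ : QuasiRiemannHypothesis (1 / 2) := h₃ δ hδ hI h₁
  exact (show QuasiRiemannHypothesis (1 / 2) ↔ _root_.RiemannHypothesis from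
    quasiRiemannHypothesis_one_half_iff_holds).mp hQ

/-- **The skeleton theorem**: the crux BY NAME from the three registered stubs (depends on `sorryAx`
only through `stub_*`; becomes the crux proof when the stubs land). -/
theorem LiouvilleSineCriterion_proof :
    Summit.RiemannHypothesis.RiemannHypothesis.Theses.CharacterSums.LiouvilleSineCriterion :=
  LiouvilleSineCriterion_of stub_mellinIdentity stub_landauContinuation stub_zeroFree

/-! ## Calibration (sorry-free) -/

/-- The registered stubs are literally the `Sig` propositions. -/
example :
    (Sig.stub_mellinIdentity ↔ (∀ s : ℂ, 0 < s.re → s.re < 1 →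
        HasMellin (fun x : ℝ => (Conrey2024.f x : ℂ)) (s - 1)
          ((2 * π : ℂ) ^ (1 - s) * (Complex.Gamma s / (1 - s)) * Complex.cos (π * s / 2) *
            (riemannZeta (2 * s + 2) / riemannZeta (s + 1))))) ∧
    (Sig.stub_landauContinuation ↔ (∀ δ : ℝ, 0 < δ → (∀ x : ℝ, 0 ≤ x → x ≤ δ → 0 ≤ Conrey2024.f x) →
      (∀ s : ℂ, 0 < s.re → s.re < 1 →
        HasMellin (fun x : ℝ => (Conrey2024.f x : ℂ)) (s - 1)
          ((2 * π : ℂ) ^ (1 - s) * (Complex.Gamma s / (1 - s)) * Complex.cos (π * s / 2) *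
            (riemannZeta (2 * s + 2) / riemannZeta (s + 1)))) →
      ∀ σ : ℝ, -1 / 2 < σ →
        IntegrableOn (fun x : ℝ => Conrey2024.f x * x ^ (σ - 2)) (Set.Ioc 0 δ))) ∧
    (Sig.stub_zeroFree ↔ (∀ δ : ℝ, 0 < δ →
      (∀ σ : ℝ, -1 / 2 < σ →
        IntegrableOn (fun x : ℝ => Conrey2024.f x * x ^ (σ - 2)) (Set.Ioc 0 δ)) →
      (∀ s : ℂ, 0 < s.re → s.re < 1 →
        HasMellin (fun x : ℝ => (Conrey2024.f x : ℂ)) (s - 1)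
          ((2 * π : ℂ) ^ (1 - s) * (Complex.Gamma s / (1 - s)) * Complex.cos (π * s / 2) *
            (riemannZeta (2 * s + 2) / riemannZeta (s + 1)))) →
      QuasiRiemannHypothesis (1 / 2))) :=
  ⟨Iff.rfl, Iff.rfl, Iff.rfl⟩

/-- Calibration: the positivity hypothesis of the crux is literally positivity of `Conrey2024.f`
(the crux's `tsum` is `Conrey2024.f x` unfolded). -/
example (δ : ℝ) :
    (∀ x : ℝ, 0 ≤ x → x ≤ δ → 0 ≤ ∑' n : ℕ, (ArithmeticFunction.liouville n : ℝ) *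
        Real.sin (2 * Real.pi * n * x) / (n : ℝ) ^ 2) ↔
    (∀ x : ℝ, 0 ≤ x → x ≤ δ → 0 ≤ Conrey2024.f x) :=
  Iff.rfl

end Summit.RiemannHypothesis.RiemannHypothesis.Cruxes.LiouvilleSineCriterion.Birth

end
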